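import Summits.Parity.BatemanHorn.Theorems.AlmostPrimeZerosSystemLSDRealSegmentLinearSegmentLaw
import Summits.Parity.BatemanHorn.Theorems.SystemLSDRealSegment.Negative.FinZero
import Literature.NumberTheory.Sieve.BatemanHornProofs
import HarnessLib

/-!
# `SystemLSDRealSegment` (stmt-Parity-11292), line `beta-thinned-root-kernel`: the family classes of the open kernel law

Sorry-free glue of the lead's rev L4 skeleton (continuation lead c2, 2026-08-16).  With `TypeILaw` a theorem for every
Bateman–Horn system (`typeILaw_holds`) and the crux equivalent, family by family, to the kernel law `BetaKernelLaw`
(`betaKernelLaw_iff_segmentLaw`, `systemLSDRealSegment_of_betaKernelLaw`), the open content of the crux splits along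
the FAMILY CLASSES of Bateman–Horn systems.  Every member of a system has `deg ≥ 1`
(`IsBatemanHornSystem.natDegree_pos`), so a system of total degree `Σᵢ deg fᵢ ≤ 2` is one of: `k = 0` (empty kernel —
`betaKernelLaw_fin_zero` below), `k = 1` linear (LANDED: `betaKernelLaw_of_natDegree_eq_one`,
`conclusion_of_natDegree_eq_one`), `k = 1` quadratic, or `k = 2` with two linear members.  Hence:

* `betaKernelLaw_of_classes` — the kernel law for ALL systems on the segment from the three classes
  LINEAR PAIR (`k = 2`, both `deg = 1`), QUADRATIC (`k = 1`, `deg = 2`), TOTAL DEGREE `≥ 3`;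
* `systemLSDRealSegment_of_kernelClasses` — the crux from those three kernel-law classes;
* `conclusion_of_betaKernelLaw` — for ONE family, the kernel law on the segment gives the crux's conclusion for that
  family with `Λ := eulerFactor f` (the per-family form of `systemLSDRealSegment_of_betaKernelLaw`);
* `systemLSDRealSegment_of_restrictions` — the crux from its own RESTRICTIONS to the same three classes (crux
  vocabulary only: the shape in which a planner can file the classes as items; glue for a split of stmt-Parity-11292).

The three classes carry three different literatures: binary additive-divisor problems / dispersion (linear pairs:
Ingham–Estermann at `y = 2`, Drappeau–Topacogullari for `(d_z, τ)`), roots of quadratic congruences beyond level `x`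
(Hooley 1963/1964, Duke–Friedlander–Iwaniec 1995, Tóth 2000: level `x^{1+δ}`, `y = 2` only), and nothing in print for
total degree `≥ 3` even at `y = 2`.
-/

open Filter Finset Polynomial
open scoped BigOperators Topology

namespace Summit.Parity.BatemanHorn.Cruxes.SystemLSDRealSegment.BetaThinnedRootKernel

open Literature.NumberTheory.Sieve
open Summit.Parity.BatemanHorn.Theses.AlmostPrimeZeros (SystemLSDRealSegment)

noncomputable section

/-! ### The empty system -/

/-- `k = 0`: the kernel is EMPTY from `x = 1` on (the only divisor tuple is the empty one, of product `1 ≤ x`), and the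
forced constant is `λ(y)·(e⁰·1 − Γ(1)⁻¹) = 0`; so `BetaKernelLaw 0 f y` holds for every `f : Fin 0 → ℤ[X]` and every
real `y`. [folklore] -/
theorem kernelLaw_fin_zero (f : Fin 0 → ℤ[X]) (y : ℝ) : BetaKernelLaw 0 f y := by
  unfold BetaKernelLaw
  have hconst : eulerFactor f y *
      (Complex.exp (((y : ℂ) - 1) * (Real.log (∏ i : Fin 0, ((f i).natDegree : ℝ)) : ℂ)) *
          (Complex.Gamma y)⁻¹ ^ (0 : ℕ) -
        (Complex.Gamma (((0 : ℕ) : ℂ) * ((y : ℂ) - 1) + 1))⁻¹) = 0 := by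
    simp [Complex.Gamma_one]
  rw [hconst]
  refine tendsto_const_nhds.congr' ?_
  filter_upwards [eventually_ge_atTop 1] with x hx
  have hK : kernelSum f y x = 0 := by
    unfold kernelSum
    refine Finset.sum_eq_zero fun n _ => Finset.sum_eq_zero fun d hd => ?_
    rw [Finset.mem_filter] at hd
    exact absurd hd.2 (by simp; omega)
  simp [hK]

/-- **betaKernelLaw_fin_zero** (registered helper of stmt-Parity-11292): the `k = 0` case of the kernel law, for every
empty family and every real `y` (`kernelLaw_fin_zero`). [folklore] -/
theorem betaKernelLaw_fin_zero : ∀ (f : Fin 0 → ℤ[X]) (y : ℝ), BetaKernelLaw 0 f y := kernelLaw_fin_zero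

/-! ### The kernel law by family class -/

/-- **The case split for the kernel law**: `BetaKernelLaw k f y` for EVERY Bateman–Horn system `f` and every
`y ∈ (5/4, 7/4)` follows from the three family classes — LINEAR PAIRS (`k = 2`, both members of degree `1`), a single
QUADRATIC (`k = 1`, degree `2`), and TOTAL DEGREE `Σᵢ deg fᵢ ≥ 3` —, the remaining systems (`k = 0`; `k = 1` linear)
being theorems (`betaKernelLaw_fin_zero`, `betaKernelLaw_of_natDegree_eq_one`).  Uses only that every member of a
Bateman–Horn system is non-constant (`IsBatemanHornSystem.natDegree_pos`). [folklore] -/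
theorem betaKernelLaw_of_classes : (∀ f : Fin 2 → ℤ[X], IsBatemanHornSystem f → (f 0).natDegree = 1 → (f 1).natDegree = 1 → ∀ y : ℝ, 5 / 4 < y → y < 7 / 4 → BetaKernelLaw 2 f y) → (∀ f : Fin 1 → ℤ[X], IsBatemanHornSystem f → (f 0).natDegree = 2 → ∀ y : ℝ, 5 / 4 < y → y < 7 / 4 → BetaKernelLaw 1 f y) → (∀ (k : ℕ) (f : Fin k → ℤ[X]), IsBatemanHornSystem f → 3 ≤ ∑ i, (f i).natDegree → ∀ y : ℝ, 5 / 4 < y → y < 7 / 4 → BetaKernelLaw k f y) → ∀ (k : ℕ) (f : Fin k → ℤ[X]), IsBatemanHornSystem f → ∀ y : ℝ, 5 / 4 < y → y < 7 / 4 → BetaKernelLaw k f y := by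
  intro hP hQ hR k f hf y hy hy'
  by_cases hT : 3 ≤ ∑ i, (f i).natDegree
  · exact hR k f hf hT y hy hy'
  rw [not_le] at hT
  have hdeg : ∀ i, 1 ≤ (f i).natDegree := fun i => hf.natDegree_pos i
  have hk : k ≤ ∑ i, (f i).natDegree := by
    calc k = ∑ _i : Fin k, 1 := by simp
      _ ≤ ∑ i, (f i).natDegree := Finset.sum_le_sum fun i _ => hdeg i
  match k, f, hf, hT, hdeg, hk with
  | 0, f, hf, _, _, _ => exact betaKernelLaw_fin_zero f y
  | 1, f, hf, hT, hdeg, _ =>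
    have h1 : (f 0).natDegree ≤ 2 := by
      have : ∑ i, (f i).natDegree = (f 0).natDegree := by simp
      omega
    rcases Nat.lt_or_ge ((f 0).natDegree) 2 with h | h
    · exact betaKernelLaw_of_natDegree_eq_one f hf (by have := hdeg 0; omega) y (by linarith)
    · exact hQ f hf (by omega) y hy hy'
  | 2, f, hf, hT, hdeg, _ =>
    have hsum : ∑ i, (f i).natDegree = (f 0).natDegree + (f 1).natDegree := by
      simp [Fin.sum_univ_two]
    have h0 := hdeg 0
    have h1 := hdeg 1
    exact hP f hf (by omega) (by omega) y hy hy'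
  | k + 3, f, hf, hT, _, hk => omega

/-- **The crux from the three kernel-law classes** (composition of `betaKernelLaw_of_classes` with the landed reduction
`systemLSDRealSegment_of_betaKernelLaw`): the statement of the lead's rev L4 skeleton with its three stubs as
hypotheses. [folklore] -/
theorem systemLSDRealSegment_of_kernelClasses
    (hP : ∀ f : Fin 2 → ℤ[X], IsBatemanHornSystem f → (f 0).natDegree = 1 → (f 1).natDegree = 1 →
      ∀ y : ℝ, 5 / 4 < y → y < 7 / 4 → BetaKernelLaw 2 f y)
    (hQ : ∀ f : Fin 1 → ℤ[X], IsBatemanHornSystem f → (f 0).natDegree = 2 →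
      ∀ y : ℝ, 5 / 4 < y → y < 7 / 4 → BetaKernelLaw 1 f y)
    (hR : ∀ (k : ℕ) (f : Fin k → ℤ[X]), IsBatemanHornSystem f → 3 ≤ ∑ i, (f i).natDegree →
      ∀ y : ℝ, 5 / 4 < y → y < 7 / 4 → BetaKernelLaw k f y) :
    SystemLSDRealSegment :=
  systemLSDRealSegment_of_betaKernelLaw (betaKernelLaw_of_classes hP hQ hR)

/-! ### One family at a time -/

/-- **Per-family closure**: for ONE Bateman–Horn system `f`, the kernel law on the segment `(5/4, 7/4)` gives the
crux's conclusion FOR THAT FAMILY, with the explicit witness `Λ := eulerFactor f` (holomorphic on `|z| < 2` with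
`Λ(0) = C(f)` by `eulerFactorClause_holds`; segment law by `betaKernelLaw_iff_segmentLaw`).  The per-family form of
`systemLSDRealSegment_of_betaKernelLaw`: whoever proves a class of the kernel law closes the corresponding restriction
of the crux. [folklore] -/
theorem conclusion_of_betaKernelLaw {k : ℕ} {f : Fin k → ℤ[X]} (hf : IsBatemanHornSystem f)
    (hK : ∀ y : ℝ, 5 / 4 < y → y < 7 / 4 → BetaKernelLaw k f y) :
    ∃ Λ : ℂ → ℂ, DifferentiableOn ℂ Λ (Metric.ball 0 2) ∧ Λ 0 = (batemanHornConst f : ℂ) ∧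
      ∀ y : ℝ, 5 / 4 < y → y < 7 / 4 →
        Tendsto (fun x : ℕ => (x : ℂ)⁻¹ * Complex.exp ((k : ℂ) * (1 - (y : ℂ)) * (Real.log (Real.log x) : ℂ)) *
            ∑ n ∈ range (x + 1),
              (y : ℂ) ^ (∑ i, (((f i).eval (n : ℤ)).toNat.factorization.sum fun _ v => min v 2)))
          atTop
          (𝓝 (Λ y * Complex.exp (((y : ℂ) - 1) * (Real.log (∏ i, ((f i).natDegree : ℝ)) : ℂ)) *
            (Complex.Gamma y)⁻¹ ^ k)) :=
  ⟨eulerFactor f, (eulerFactorClause_holds k f hf).1, (eulerFactorClause_holds k f hf).2,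
    fun y hy hy' => (betaKernelLaw_iff_segmentLaw hf (by linarith)).1 (hK y hy hy')⟩

/-! ### The crux from its own restrictions to the three classes -/

/-- **Glue for a split of stmt-Parity-11292 by family class** (crux vocabulary only — no line-posited objects): the crux
`SystemLSDRealSegment` follows from its RESTRICTIONS to LINEAR PAIRS (`k = 2`, both degrees `1`), to a single
QUADRATIC (`k = 1`, degree `2`) and to TOTAL DEGREE `≥ 3`; the other Bateman–Horn systems are the empty one
(`systemLSDRealSegment_fin_zero`, landed) and the linear ones (`conclusion_of_natDegree_eq_one`, landed).  Each
restriction is verbatim the crux's body under the class hypothesis, so a planner may file the three classes as items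
and cite this theorem as the glue. [folklore] -/
theorem systemLSDRealSegment_of_restrictions
    (hP : ∀ f : Fin 2 → ℤ[X], IsBatemanHornSystem f → (f 0).natDegree = 1 → (f 1).natDegree = 1 →
      ∃ Λ : ℂ → ℂ, DifferentiableOn ℂ Λ (Metric.ball 0 2) ∧ Λ 0 = (batemanHornConst f : ℂ) ∧
        ∀ y : ℝ, 5 / 4 < y → y < 7 / 4 →
          Tendsto (fun x : ℕ => (x : ℂ)⁻¹ *
              Complex.exp (((2 : ℕ) : ℂ) * (1 - (y : ℂ)) * (Real.log (Real.log x) : ℂ)) *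
              ∑ n ∈ range (x + 1),
                (y : ℂ) ^ (∑ i, (((f i).eval (n : ℤ)).toNat.factorization.sum fun _ v => min v 2)))
            atTop
            (𝓝 (Λ y * Complex.exp (((y : ℂ) - 1) * (Real.log (∏ i, ((f i).natDegree : ℝ)) : ℂ)) *
              (Complex.Gamma y)⁻¹ ^ (2 : ℕ))))
    (hQ : ∀ f : Fin 1 → ℤ[X], IsBatemanHornSystem f → (f 0).natDegree = 2 →
      ∃ Λ : ℂ → ℂ, DifferentiableOn ℂ Λ (Metric.ball 0 2) ∧ Λ 0 = (batemanHornConst f : ℂ) ∧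
        ∀ y : ℝ, 5 / 4 < y → y < 7 / 4 →
          Tendsto (fun x : ℕ => (x : ℂ)⁻¹ *
              Complex.exp (((1 : ℕ) : ℂ) * (1 - (y : ℂ)) * (Real.log (Real.log x) : ℂ)) *
              ∑ n ∈ range (x + 1),
                (y : ℂ) ^ (∑ i, (((f i).eval (n : ℤ)).toNat.factorization.sum fun _ v => min v 2)))
            atTop
            (𝓝 (Λ y * Complex.exp (((y : ℂ) - 1) * (Real.log (∏ i, ((f i).natDegree : ℝ)) : ℂ)) *
              (Complex.Gamma y)⁻¹ ^ (1 : ℕ))))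
    (hR : ∀ (k : ℕ) (f : Fin k → ℤ[X]), IsBatemanHornSystem f → 3 ≤ ∑ i, (f i).natDegree →
      ∃ Λ : ℂ → ℂ, DifferentiableOn ℂ Λ (Metric.ball 0 2) ∧ Λ 0 = (batemanHornConst f : ℂ) ∧
        ∀ y : ℝ, 5 / 4 < y → y < 7 / 4 →
          Tendsto (fun x : ℕ => (x : ℂ)⁻¹ *
              Complex.exp ((k : ℂ) * (1 - (y : ℂ)) * (Real.log (Real.log x) : ℂ)) *
              ∑ n ∈ range (x + 1),
                (y : ℂ) ^ (∑ i, (((f i).eval (n : ℤ)).toNat.factorization.sum fun _ v => min v 2)))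
            atTop
            (𝓝 (Λ y * Complex.exp (((y : ℂ) - 1) * (Real.log (∏ i, ((f i).natDegree : ℝ)) : ℂ)) *
              (Complex.Gamma y)⁻¹ ^ k))) :
    SystemLSDRealSegment := by
  intro k f hf
  by_cases hT : 3 ≤ ∑ i, (f i).natDegree
  · exact hR k f hf hT
  rw [not_le] at hT
  have hdeg : ∀ i, 1 ≤ (f i).natDegree := fun i => hf.natDegree_pos i
  have hk : k ≤ ∑ i, (f i).natDegree := by
    calc k = ∑ _i : Fin k, 1 := by simp
      _ ≤ ∑ i, (f i).natDegree := Finset.sum_le_sum fun i _ => hdeg i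
  match k, f, hf, hT, hdeg, hk with
  | 0, f, hf, _, _, _ =>
    exact Summit.Parity.BatemanHorn.Theorems.SystemLSDRealSegment.Negative.systemLSDRealSegment_fin_zero f hf
  | 1, f, hf, hT, hdeg, _ =>
    have h1 : (f 0).natDegree ≤ 2 := by
      have : ∑ i, (f i).natDegree = (f 0).natDegree := by simp
      omega
    rcases Nat.lt_or_ge ((f 0).natDegree) 2 with h | h
    · exact conclusion_of_natDegree_eq_one f hf (by have := hdeg 0; omega)
    · exact hQ f hf (by omega)
  | 2, f, hf, hT, hdeg, _ =>
    have hsum : ∑ i, (f i).natDegree = (f 0).natDegree + (f 1).natDegree := by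
      simp [Fin.sum_univ_two]
    have h0 := hdeg 0
    have h1 := hdeg 1
    exact hP f hf (by omega) (by omega)
  | k + 3, f, hf, hT, _, hk => omega

end

end Summit.Parity.BatemanHorn.Cruxes.SystemLSDRealSegment.BetaThinnedRootKernel
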